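import Literature.MathematicalPhysics.QuantumFieldTheory.Balaban1983to89.B9SmoothHolderClassS
import Literature.MathematicalPhysics.QuantumFieldTheory.Balaban1983to89.B9Thm312Whole

/-!
# `Balaban1983to89.B9SmoothHolderClassSReadings` — THE FIRST CLASS FACT OF THE SMOOTH-PARTITION HÖLDER CLASS `bHZ`: the identity map from `bHZ ε p` (`p ≥ 1`)
# into the sharp `(Lʲη)^{−1}`-weighted sup class `𝔠⁽¹⁾ = cNorm … 1` of rows 20–21 has a member-uniform decaying majorant — the displayed class axiom
# `hX : HasMaj bXH (cNorm blk 1) id (κX·e^{−δX d})` of the re-cut letters (`B9Thm313WholeCutLettersSupFrom344.wGp_of_h44Gp ∕ pWE_of_p45Gp`) AT THE PIN `bXH := bHZ`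

T. Bałaban, *Propagators for lattice gauge theories in a background field*, Commun. Math. Phys. **99** (1985) 389–434
[`Balaban1985BackgroundPropagators`, "B9"]; [4] = T. Bałaban, *Propagators and renormalization transformations for lattice gauge
theories. II*, Commun. Math. Phys. **96** (1984) 223–250 [`Balaban1984PropagatorsII`].

statement-level skeleton of published theorems with citation tags; proofs where landed; nothing here is a claim about the
Yang–Mills mass gap

THE PRINTED LOCI.  [B9] (3.41)–(3.42) p. 397 (the `(Lʲη)^{−1}`-weighted sup entries), (3.43)–(3.45) p. 398 (*"supp λ ⊂ Δ̃(y′)"*, *"(‖λ‖_ε + |λ|)"* — the sup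
of a vector in the Hölder input class is one of its two displayed sizes); [4] (2.51)–(2.54) p. 232 (block majorants, `d(y, y′)`, the triangle inequality).

WHY THIS FILE (cell `pub-ymgap`, node N06, seat dag-n06-l g20; fourth piece of the (F1) programme).  n06-l g19's schema-level suppliers of the re-cut letters
(`wGp_of_h44Gp`, `pWE_of_p45Gp` in `B9Thm313WholeCutLettersSupFrom344`) take the class axiom
`hX : HasMaj bXH (cNorm R₀ H₀ 𝔬.blk hG.lenle 1) LinearMap.id (fun a b => κX * exp (−δX·d a b))` about the FREE class `bXH`.  At the pin `bXH := bHZ i hε0 hε1 hεp` with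
sup power `p ≥ 1` and the certificate's site block map `𝔬.blk = blkSK (sIK bI)` this axiom is a THEOREM: a vector localised at `y′` in `bHZ` vanishes off `Δ̃(y′)`, so its
sharp-block sup at `y` vanishes unless the block `β y` meets `Δ̃(y′)` — then `d(y, y′) ≤ r` (n06-w6's LAYER B `hN`, displayed here) and `|j(y) − j(y′)| ≤ 1` (the
two-level window), whence `(Lʲ⁽ʸ⁾η)^{−1}·sup_{Δ(y)}|μ| ≤ L·(L^{j(y′)}η)^{−1}·sup_{Δ̃(y′)}|μ| ≤ L·loc^{bHZ}_{y′} μ` (`Wscl 1 ≤ Wscl p`).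
* ★★ `hasMaj_id_bHZ_cNorm` — `HasMaj (bHZ i hε0 hε1 hεp) (cNorm R H (blkSK i (sIK i bI)) hlen 1) LinearMap.id (fun y y′ => L·e^{δr}·e^{−δ·d(y,y′)})` for every `δ ≥ 0`,
  given `1 ≤ p`, a level-faithful `bI` (`hlev`, the certificate's binder), the displayed enlargement radius `hN : NearY i y z → d(y, sIK bI z) ≤ r` (n06-w6's LAYER B
  `B9MultiscaleSmoothPartitionYNear` discharges it) and `|c_f| ≤ Lᵏ` (equality at the members of record, `η = L^{−k}`).
* `bHZ_κ_le` — the uniform cutting-cost binder `hκX : (bXH x).κ ≤ κ13` at the pin, with `κ13 := 1 + C_Lip(d, L)`.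
HONEST SCOPE.  Bookkeeping over landed definitions; the radius `r` is displayed (LAYER B discharges it); nothing of [B9]∕[4] asserted; no certificate edit; COUNT-NEUTRAL;
N06 NOT discharged; nothing continuum, nothing about the mass gap.  Cell `pub-ymgap` (HUMAN RULING D-0062), Track A node N06 [B9], seat `pub-ymgap-dag-n06-l` (g20),
2026-08-28.
-/

noncomputable section

namespace Literature.MathematicalPhysics.QuantumFieldTheory.Balaban1983to89.B9SmoothHolderClassSReadings

open B6Geom246MultiLevelBox (blkOf)
open B6Geom246MultiLevelTorus (bondT)
open B6Ineq2142KLevelV1 (β lvl)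
open B6KLevelCensusIndexV1 (KIdx len_eq)
open B6Prop22KLevelTorusCensusEta (nKT one_le_nKT)
open B6GlobalChartV1 (blkV1)
open B9GeoNormsKLevelV1 (geo9K geo9K_len_kGeo)
open B9Thm34Ext (toB6)
open B11SectG (BlockNorm HasMaj)
open B11SectGGlobal (Size)
open B11SectGGlobalSizes
open B9SectDSup (weightNorm weightNorm_loc)
open B9Thm312Whole (cNorm wt)
open B9CoReadingCoordsS (XSK sIK blkSK sIK_level)
open B9MultiscaleSmoothPartitionY (scl scl_pos NearY levY_window_of_nearY levY_eq_blkOf)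
open B9MultiscaleSmoothPartitionYLip (CLip)
open B9SmoothHolderClassS (bHZ bHZ_κ bHZ_loc bHZ_isLoc_iff Wscl Wscl_nonneg Wscl_mono NearPair wEta wEta_nonneg)
open Node00 (SiteY FBondY IBondY toKT levY)

variable {d ℓ : ℕ} {hd : 1 ≤ d + 1} {hL : Odd (ℓ + 1) ∧ 1 < ℓ + 1} {b₀ b₁ : ℝ}
variable {κ : Type} [Fintype κ]
variable (i : KIdx d ℓ hd hL b₀ b₁)

/-- the weight of `𝔠⁽¹⁾` at an index bond: `(Lʲ⁽ʸ⁾η)^{−1} = |c_f| ∕ L^{j(y)}`. [cite: Balaban1985BackgroundPropagators, (3.41) p.397, dictionary] -/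
theorem wt_one_eq (y : IBondY i) : wt (geo9K i) 1 y = |i.cf| / scl i y := by
  rw [wt, pow_one, geo9K_len_kGeo, len_eq, scl, inv_div]

/-- `Wscl 1 y = Lᵏ ∕ L^{j(y)}` (`(Lʲη)^{−1}` with `η = L^{−k}`). [cite: Balaban1985BackgroundPropagators, (3.41) p.397, dictionary] -/
theorem Wscl_one_eq (y : IBondY i) : Wscl i 1 y = (nKT (toKT i) : ℝ) / scl i y := by
  rw [Wscl, Real.rpow_one, inv_div]

section WithSite

variable [Fintype (geo9K i).Site]

open Classical in
/-- the sharp-block sup of a vector vanishing off `Δ̃(y′)` is below its `Δ̃(y′)`-sup size. [cite: Balaban1985BackgroundPropagators, (3.44) p.398 («supp λ ⊂ Δ̃(y′)»), bookkeeping] -/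
theorem ofBlocks_loc_le_ofSup {R : ℝ} {H : Prop} (blk : XSK κ i → IBondY i) {y' : IBondY i} {μ : XSK κ i → ℝ}
    (hμ : ∀ q : XSK κ i, ¬ NearY i y' q.1 → μ q = 0) (y : IBondY i) :
    (BlockNorm.ofBlocks (toB6 (geo9K i) R H) blk).loc y μ ≤
      (Size.ofSup (toB6 (geo9K i) R H) (fun (q : XSK κ i) (y : IBondY i) => NearY i y q.1)).sz y' μ := by
  show (⨆ q : XSK κ i, @ite ℝ (blk q = y) (Classical.propDecidable _) |μ q| 0) ≤ _
  refine Real.iSup_le (fun q => ?_) (Size.nonneg _ _ _)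
  split_ifs with hq
  · by_cases hμq : μ q = 0
    · rw [hμq, abs_zero]; exact Size.nonneg _ _ _
    · exact ofSup_abs_le _ (show NearY i y' q.1 from by by_contra hn; exact hμq (hμ q hn)) μ
  · exact Size.nonneg _ _ _

/-- … and vanishes when no site of the block carries a nonzero value. [cite: Balaban1984PropagatorsII, (2.51) p.232, bookkeeping] -/
theorem ofBlocks_loc_eq_zero {R : ℝ} {H : Prop} (blk : XSK κ i → IBondY i) {y : IBondY i} {μ : XSK κ i → ℝ}
    (h : ∀ q : XSK κ i, blk q = y → μ q = 0) : (BlockNorm.ofBlocks (toB6 (geo9K i) R H) blk).loc y μ = 0 := by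
  refine le_antisymm ?_ ((BlockNorm.ofBlocks (toB6 (geo9K i) R H) blk).loc_nonneg y μ)
  show (⨆ q : XSK κ i, @ite ℝ (blk q = y) (Classical.propDecidable _) |μ q| 0) ≤ 0
  refine Real.iSup_le (fun q => ?_) le_rfl
  split_ifs with hq
  · rw [h q hq, abs_zero]
  · exact le_rfl

/-- ★★ **THE CLASS AXIOM `hX` AT THE PIN `bXH := bHZ`**: the identity map from the smooth-partition Hölder class (sup power `p ≥ 1`) into the sharp `(Lʲη)^{−1}`-weighted sup
class `𝔠⁽¹⁾` over the site block map `blkSK (sIK bI)` has the majorant `L·e^{δr}·e^{−δ·d(y,y′)}` for every `δ ≥ 0` (`|c_f| ≤ Lᵏ`) — a vector localised at `y′` vanishes off `Δ̃(y′)`; a block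
`y` where it does not vanish identically carries a site of `Δ̃(y′)`, so `d(y, y′) ≤ r` (the displayed enlargement radius `hN`) and `j(y) ≥ j(y′) − 1` (two-level window, level-faithful
`bI`), whence `(Lʲ⁽ʸ⁾η)^{−1} ≤ L·(L^{j(y′)}η)^{−1}` and the sharp sup is below the `Δ̃(y′)`-sup. [cite: Balaban1985BackgroundPropagators, (3.41)–(3.42) p.397 + (3.44) p.398; Balaban1984PropagatorsII, (2.51)–(2.54) p.232] -/
theorem hasMaj_id_bHZ_cNorm {R : ℝ} {H : Prop} {ε p : ℝ} (hε0 : 0 ≤ ε) (hε1 : ε ≤ 1) (hεp : ε ≤ p) (h1p : 1 ≤ p)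
    (hlen : ∀ y : (geo9K i).Site, 0 ≤ (geo9K i).len y) {bI : FBondY i → IBondY i}
    (hlev : ∀ f : FBondY i, lvl i.hN i.D i.hk (bI f) = (blkV1 i.hN i.D f).1.1)
    {r δ : ℝ} (hδ : 0 ≤ δ) (hN : ∀ (y : IBondY i) (z : SiteY i), NearY i y z → (geo9K i).dist y (sIK i bI z) ≤ r)
    (hcf : |i.cf| ≤ (nKT (toKT i) : ℝ)) :
    HasMaj (bHZ (κ := κ) i (R := R) (H := H) hε0 hε1 hεp) (cNorm R H (blkSK i (sIK i bI)) hlen 1) LinearMap.id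
      (fun y y' => (((ℓ + 1 : ℕ) : ℝ)) * Real.exp (δ * r) * Real.exp (-(δ * (geo9K i).dist y y'))) := by
  classical
  intro y' μ hμ y
  rw [bHZ_isLoc_iff] at hμ
  rw [LinearMap.id_apply]
  have hL0 : (0 : ℝ) ≤ ((ℓ + 1 : ℕ) : ℝ) := Nat.cast_nonneg _
  have hL1 : (1 : ℝ) ≤ ((ℓ + 1 : ℕ) : ℝ) := by exact_mod_cast Nat.succ_le_succ (Nat.zero_le ℓ)
  have hloc0 : 0 ≤ (bHZ (κ := κ) i (R := R) (H := H) hε0 hε1 hεp).loc y' μ := BlockNorm.loc_nonneg _ _ _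
  have hK0 : 0 ≤ (((ℓ + 1 : ℕ) : ℝ)) * Real.exp (δ * r) * Real.exp (-(δ * (geo9K i).dist y y')) := by positivity
  have hcN : (cNorm R H (blkSK i (sIK i bI)) hlen 1).loc y μ =
      wt (geo9K i) 1 y * (BlockNorm.ofBlocks (toB6 (geo9K i) R H) (blkSK i (sIK i bI))).loc y μ := rfl
  by_cases hex : ∃ q : XSK κ i, blkSK i (sIK i bI) q = y ∧ μ q ≠ 0
  · obtain ⟨q, hq, hμq⟩ := hex
    have hnear : NearY i y' q.1 := by by_contra hn; exact hμq (hμ q hn)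
    -- the block of `q` is `r`-close to `y′`
    have hdist : (geo9K i).dist y y' ≤ r := by
      have h := hN y' q.1 hnear
      have hsym : (geo9K i).dist y y' = (geo9K i).dist y' y := by
        show (((bondT i.D).dist _ _ : ℕ) : ℝ) = (((bondT i.D).dist _ _ : ℕ) : ℝ)
        rw [SimpleGraph.dist_comm]
      rw [hsym, ← hq]; exact h
    have hexp : 1 ≤ Real.exp (δ * r) * Real.exp (-(δ * (geo9K i).dist y y')) := by
      rw [← Real.exp_add]; exact Real.one_le_exp (by nlinarith)
    -- levels: `j(y) = lev q.1 ≥ j(y′) − 1`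
    have hly : lvl i.hN i.D i.hk y = levY i q.1 := by rw [← hq]; exact (sIK_level i hlev q.1).trans (levY_eq_blkOf i q.1).symm
    have hwin := (levY_window_of_nearY i hnear).1
    rw [← hly] at hwin
    -- weights: `wt 1 y ≤ L · Wscl p y′`
    have hs := scl_pos i y
    have hs' := scl_pos i y'
    have hscl : scl i y' ≤ ((ℓ + 1 : ℕ) : ℝ) * scl i y := by
      rw [scl, scl, ← pow_succ']; exact pow_le_pow_right₀ hL1 hwin
    have hwt : wt (geo9K i) 1 y ≤ ((ℓ + 1 : ℕ) : ℝ) * Wscl i p y' := by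
      have h1 : wt (geo9K i) 1 y ≤ ((ℓ + 1 : ℕ) : ℝ) * Wscl i 1 y' := by
        rw [wt_one_eq, Wscl_one_eq, mul_div_assoc', div_le_div_iff₀ hs hs']
        calc |i.cf| * scl i y' ≤ (nKT (toKT i) : ℝ) * (((ℓ + 1 : ℕ) : ℝ) * scl i y) :=
            mul_le_mul hcf hscl hs'.le (Nat.cast_nonneg _)
          _ = ((ℓ + 1 : ℕ) : ℝ) * (nKT (toKT i) : ℝ) * scl i y := by ring
      exact h1.trans (mul_le_mul_of_nonneg_left (Wscl_mono i h1p y') hL0)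
    -- the sharp sup against the `Δ̃(y′)`-sup, the latter against `loc^{bHZ}`
    have hsup := ofBlocks_loc_le_ofSup i (R := R) (H := H) (blkSK (κ := κ) i (sIK i bI)) hμ y
    have hbHZ : Wscl i p y' * (Size.ofSup (toB6 (geo9K i) R H) (fun (q : XSK κ i) (y : IBondY i) => NearY i y q.1)).sz y' μ ≤
        (bHZ (κ := κ) i (R := R) (H := H) hε0 hε1 hεp).loc y' μ := by
      rw [bHZ_loc]; exact le_add_of_nonneg_right (Size.nonneg _ _ _)
    calc (cNorm R H (blkSK i (sIK i bI)) hlen 1).loc y μ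
        = wt (geo9K i) 1 y * (BlockNorm.ofBlocks (toB6 (geo9K i) R H) (blkSK i (sIK i bI))).loc y μ := hcN
      _ ≤ (((ℓ + 1 : ℕ) : ℝ) * Wscl i p y') *
            (Size.ofSup (toB6 (geo9K i) R H) (fun (q : XSK κ i) (y : IBondY i) => NearY i y q.1)).sz y' μ :=
          mul_le_mul hwt hsup (BlockNorm.loc_nonneg _ _ _) (mul_nonneg hL0 (Wscl_nonneg i p y'))
      _ ≤ ((ℓ + 1 : ℕ) : ℝ) * (bHZ (κ := κ) i (R := R) (H := H) hε0 hε1 hεp).loc y' μ := by rw [mul_assoc]; exact mul_le_mul_of_nonneg_left hbHZ hL0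
      _ ≤ ((ℓ + 1 : ℕ) : ℝ) * (Real.exp (δ * r) * Real.exp (-(δ * (geo9K i).dist y y'))) * (bHZ (κ := κ) i (R := R) (H := H) hε0 hε1 hεp).loc y' μ := by
          rw [mul_assoc (((ℓ + 1 : ℕ) : ℝ))]
          exact mul_le_mul_of_nonneg_left (le_mul_of_one_le_left hloc0 hexp) hL0
      _ = _ := by ring
  · push Not at hex
    rw [hcN, ofBlocks_loc_eq_zero i (R := R) (H := H) (blkSK (κ := κ) i (sIK i bI)) hex, mul_zero]
    exact mul_nonneg hK0 hloc0

/-- ★ **THE UNIFORM CUTTING-COST BINDER AT THE PIN**: `(bHZ …).κ ≤ 1 + C_Lip(d, L)` (`hκX : (bXH x).κ ≤ κ13` with `κ13 := 1 + CLip d ℓ`, member-uniform).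
[cite: Balaban1984PropagatorsII, (2.52) p.232; Balaban1985BackgroundPropagators, (3.43) p.398] -/
theorem bHZ_κ_le {R : ℝ} {H : Prop} {ε p : ℝ} (hε0 : 0 ≤ ε) (hε1 : ε ≤ 1) (hεp : ε ≤ p) :
    (bHZ (κ := κ) i (R := R) (H := H) hε0 hε1 hεp).κ ≤ 1 + CLip d ℓ := le_of_eq (bHZ_κ i hε0 hε1 hεp)

end WithSite

end Literature.MathematicalPhysics.QuantumFieldTheory.Balaban1983to89.B9SmoothHolderClassSReadings
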